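import Summits.AnomalousDissipation.AnomalousDissipation.Theorems.QuarticGate.Negative.EnergyRow
import Summits.AnomalousDissipation.AnomalousDissipation.Theorems.MomentParityQuarticGateDesignSymShiftOp
import Literature.Analysis.FunctionSpaces.BesovSliceMeasurability
import Mathlib.MeasureTheory.Function.LpSpace.ContinuousCompMeasurePreserving

/-!
# A jointly continuous family of shift homeomorphisms of the energy space

Helper file for stub S1 (`stub_shiftFamily`) of the line `symmetrised-profile-frozen-quiet-split` of the
crux `MomentParity.GalerkinInvariantLoud` (stmt-AnomalousDissipation-14283).

Translation `u ↦ u(· + a)` of `L²` classes on the `3`-torus (Mathlib's `Lp.compMeasurePreservingₗᵢ` for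
the Haar-measure-preserving map `x ↦ x + a`) preserves the energy space `H` (the closed span of the smooth
solenoidal mean-zero fields, which translation permutes) and is undone by translation by `-a`; this gives
a family of homeomorphisms `T a : H ≃ₜ H` represented a.e. by `x ↦ u(x + a)` (the construction of
`Theorems.MomentParityQuarticGate.exists_shiftOp`). The new point here is the JOINT continuity of
`(a, u) ↦ T a u` on `T³ × H`, which is Mathlib's continuity of `Lp.compMeasurePreserving` in both
arguments (`Continuous.compMeasurePreservingLp`, Kudryashov 2024) along the continuous family of
translations `a ↦ (x ↦ x + a) : T³ → C(T³, T³)` (`continuous_addRight_continuousMap`).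

## Mathlib / tree search

* Mathlib: `MeasureTheory.Lp.compMeasurePreservingₗᵢ`, `MeasureTheory.Lp.coeFn_compMeasurePreserving`,
  `MeasureTheory.measurePreserving_add_right`, `Continuous.compMeasurePreservingLp`.
* Tree: `Torus.isClosed_energySpace`, `Torus.smoothSolenoidal_subset_energySpace`,
  `Theorems.MomentParityQuarticGate.isDivFree_comp_add_right`, `hasZeroMean_comp_add_right`,
  `Literature.Analysis.FunctionSpaces.continuous_addRight_continuousMap`.
-/

namespace Summit.AnomalousDissipation.AnomalousDissipation.Theorems.GalerkinInvariantLoud.ShiftFamily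

open MeasureTheory Filter Topology
open scoped ENNReal InnerProductSpace RealInnerProductSpace
open Literature.Analysis.FunctionSpaces Literature.Analysis.FluidPDE
open Summit.AnomalousDissipation.AnomalousDissipation.Theorems.QuarticGate.Negative
open Summit.AnomalousDissipation.AnomalousDissipation.Theorems.CubicParityLoud.Negative (T3 R3 H3 L2T3 frameG)

set_option linter.dupNamespace false

noncomputable section

/-- **S1 · `stub_shiftFamily` — translations act on the energy space `H` by a JOINTLY CONTINUOUS family
of homeomorphisms.** There is `T : T³ → (H ≃ₜ H)` with `T a u` represented a.e. by `x ↦ u(x + a)` and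
`(a, u) ↦ T a u` continuous on `T³ × H`. Construction: `T a = Lp.compMeasurePreservingₗᵢ ℝ (· + a)`
restricted to `H` (as in `Theorems.MomentParityQuarticGate.exists_shiftOp`: `H` is preserved and `T (-a)`
inverts `T a`); joint continuity is Mathlib's `Continuous.compMeasurePreservingLp` along the continuous
family of measure-preserving translations `a ↦ (· + a)`. [folklore] -/
theorem stub_shiftFamily :
    ∃ T : T3 → H3 ≃ₜ H3,
      (∀ (a : T3) (u : H3), ((T a u).1 : T3 → R3) =ᵐ[volume] fun x => (u.1 : T3 → R3) (x + a)) ∧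
      Continuous (fun p : T3 × H3 => T p.1 p.2) := by
  -- adapted from MomentParityQuarticGateDesignSymShiftOp.exists_shiftOp (joint continuity added)
  have hmp : ∀ a : T3, MeasurePreserving (fun x : T3 => x + a) volume volume :=
    fun a => measurePreserving_add_right volume a
  set S : T3 → Lp (EuclideanSpace ℝ (Fin 3)) 2 (volume : Measure (UnitAddTorus (Fin 3))) →ₗᵢ[ℝ]
      Lp (EuclideanSpace ℝ (Fin 3)) 2 (volume : Measure (UnitAddTorus (Fin 3))) :=
    fun a => Lp.compMeasurePreservingₗᵢ ℝ (fun x : T3 => x + a) (hmp a) with hSdef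
  have hS : ∀ (a : T3) (v : Lp (EuclideanSpace ℝ (Fin 3)) 2 (volume : Measure (UnitAddTorus (Fin 3)))),
      ((S a v : Lp (EuclideanSpace ℝ (Fin 3)) 2 (volume : Measure (UnitAddTorus (Fin 3)))) : T3 → R3)
        =ᵐ[volume] fun x => (v : T3 → R3) (x + a) :=
    fun a v => Lp.coeFn_compMeasurePreserving v (hmp a)
  -- translation preserves `H`
  have hmem : ∀ (a : T3) (v : Lp (EuclideanSpace ℝ (Fin 3)) 2 (volume : Measure (UnitAddTorus (Fin 3)))),
      v ∈ Torus.energySpace (Fin 3) → S a v ∈ Torus.energySpace (Fin 3) := by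
    intro a v hv
    have key : Torus.energySpace (Fin 3) ≤ (Torus.energySpace (Fin 3)).comap (S a).toLinearMap := by
      refine Submodule.topologicalClosure_minimal _ ?_ ?_
      · rw [Submodule.span_le]
        rintro w ⟨g, hgs, hgd, hgm, hae⟩
        refine Torus.smoothSolenoidal_subset_energySpace ⟨fun y => g (y + a), hgs.comp_add_right a,
          Theorems.MomentParityQuarticGate.isDivFree_comp_add_right hgd a,
          Theorems.MomentParityQuarticGate.hasZeroMean_comp_add_right hgm a, ?_⟩
        exact (hS a w).trans ((hmp a).quasiMeasurePreserving.ae_eq_comp hae)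
      · exact Torus.isClosed_energySpace.preimage (S a).continuous
    exact key hv
  -- translation by `-a` undoes translation by `a`
  have hinv : ∀ (a : T3) (v : Lp (EuclideanSpace ℝ (Fin 3)) 2 (volume : Measure (UnitAddTorus (Fin 3)))),
      S (-a) (S a v) = v := by
    intro a v
    refine Lp.ext ((hS (-a) (S a v)).trans ?_)
    refine ((hmp (-a)).quasiMeasurePreserving.ae_eq_comp (hS a v)).trans (Eventually.of_forall fun x => ?_)
    simp only [Function.comp_apply, neg_add_cancel_right]
  have hinv' : ∀ (a : T3) (v : Lp (EuclideanSpace ℝ (Fin 3)) 2 (volume : Measure (UnitAddTorus (Fin 3)))),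
      S a (S (-a) v) = v := fun a v => by simpa only [neg_neg] using hinv (-a) v
  have hcont : ∀ a : T3, Continuous fun u : H3 => (⟨S a u.1, hmem a u.1 u.2⟩ : H3) :=
    fun a => ((S a).continuous.comp continuous_subtype_val).subtype_mk _
  -- joint continuity of `(a, v) ↦ S a v` on `T³ × L²` (Kudryashov): the translations `x ↦ x + a` form a
  -- continuous family `T³ → C(T³, T³)` of Haar-measure-preserving maps
  have hjoint : Continuous fun p : T3 × Lp (EuclideanSpace ℝ (Fin 3)) 2 (volume : Measure (UnitAddTorus (Fin 3))) =>
      S p.1 p.2 := by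
    have h := Continuous.compMeasurePreservingLp (μ := (volume : Measure T3)) (ν := (volume : Measure T3))
      (E := EuclideanSpace ℝ (Fin 3)) (p := (2 : ℝ≥0∞))
      (f := fun p : T3 × Lp (EuclideanSpace ℝ (Fin 3)) 2 (volume : Measure (UnitAddTorus (Fin 3))) => p.2)
      (g := fun p : T3 × Lp (EuclideanSpace ℝ (Fin 3)) 2 (volume : Measure (UnitAddTorus (Fin 3))) =>
        (⟨fun x : T3 => x + p.1, continuous_id.add continuous_const⟩ : C(T3, T3)))
      continuous_snd (continuous_addRight_continuousMap.comp continuous_fst) (fun p => hmp p.1)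
      ENNReal.ofNat_ne_top
    exact h
  have hcontJ : Continuous fun p : T3 × H3 => (⟨S p.1 p.2.1, hmem p.1 p.2.1 p.2.2⟩ : H3) :=
    (hjoint.comp (continuous_fst.prodMk (continuous_subtype_val.comp continuous_snd))).subtype_mk _
  refine ⟨fun a =>
    { toFun := fun u => ⟨S a u.1, hmem a u.1 u.2⟩
      invFun := fun u => ⟨S (-a) u.1, hmem (-a) u.1 u.2⟩
      left_inv := fun u => Subtype.ext (hinv a u.1)
      right_inv := fun u => Subtype.ext (hinv' a u.1)
      continuous_toFun := hcont a
      continuous_invFun := hcont (-a) }, fun a u => hS a u.1, ?_⟩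
  exact hcontJ

end

end Summit.AnomalousDissipation.AnomalousDissipation.Theorems.GalerkinInvariantLoud.ShiftFamily
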